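import Summits.HubbardSuperconductivity.HubbardSuperconductivity.Theorems.AnisotropyChordTowerPerturbation

/-!
# Route `AnisotropyChord` / H0 rotor rung: THE TRANSPOSITION FORM OF `H_FM − e₀` (I): permutation equivariance, `fmOp`, sum of squares
(port of theory seat `hubbard-h0-rotor-theory-1`, cycle 11, Sketch11 Part H; work-order v12b; director CYCLE-12 ruling (A); linters
`unusedSectionVars`/`unusedVariables` disabled as in the theory seat's file).  Typing/proof authority: theory seat.  Part H summary:

## Part H — THE TRANSPOSITION FORM OF `H_FM − e₀`, PERMUTATION EQUIVARIANCE OF THE TOWER, THE SUBSET-SUM FORMULA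
AND THE COUNTING IDENTITY ON REGULAR GRAPHS (memo §156 (L1)+(L3), §157(b); port spec P-12 item v12b)

`A := fmOp G` is `H_FM − e₀ = ½ Σ_{edges} (1 − T_xy)` acting on amplitudes by edge transpositions: a sum of squares
(`inner_fmOp_eq`, hence `⪰ 0`), killing every function of the particle number (`fmOp_sectorFun`), with
`⟨b, A b⟩ = 0 ⇒ b` edge-transposition invariant (`swapInvariant_of_inner_fmOp_eq_zero`; on a connected graph this is
"constant on sectors" — the connectivity step is left to the port), and commuting with `S⁺_tot` (`raiseSum_fmOp`).
`raiseIter_eq_subsetSum` writes the tower `(S⁺)^k f` as `k!`× a sum over sub-configurations; with the degree count and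
`isingW_eq` it gives the COUNTING IDENTITY `raiseIter_edgeMinusMean` (= the one-magnon closure `W φ₀ = w₀ φ₀ + (S⁺)^{n−2} u /((n−2)! N_n)`)
and `lowerSum_edgeMinusMean` (regular ⇒ `u` is a lowest-weight two-magnon vector), i.e. the inputs (L1), (L3) of THEOREM P′.
-/

set_option linter.dupNamespace false
set_option linter.unusedSectionVars false
set_option linter.unusedVariables false
set_option autoImplicit false

noncomputable section

open Finset Filter Topology
open Summit.HubbardSuperconductivity.HubbardSuperconductivity.Theorems.AnisotropyChord.InsertionEntropy
open Literature.MathematicalPhysics.QuantumLattice Literature.Probability.LatticeModels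

namespace Summit.HubbardSuperconductivity.HubbardSuperconductivity.Theorems.AnisotropyChord.Tower

section Transposition

variable {V : Type} [Fintype V] [DecidableEq V]

/-! ### H.1 permutation equivariance of the raising operator -/

/-- the permutation action on amplitudes `(π • b)(σ) = b(σ ∘ π)`. -/
def permAct (π : Equiv.Perm V) (b : (V → Fin 2) → ℝ) : (V → Fin 2) → ℝ := fun σ => b (σ ∘ ⇑π)

/-- Relabelling commutes with updating a site. [folklore] -/
theorem update_comp_perm (σ : V → Fin 2) (π : Equiv.Perm V) (x : V) (i : Fin 2) :
    Function.update (σ ∘ ⇑π) x i = (Function.update σ (π x) i) ∘ ⇑π := by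
  funext z
  simp only [Function.comp_apply]
  by_cases h : z = x
  · subst h; simp
  · have : π z ≠ π x := fun h' => h (π.injective h')
    rw [Function.update_of_ne h, Function.update_of_ne this, Function.comp_apply]

/-- `S⁺_tot` commutes with the permutation action: `B†(π • b) = π • (B† b)`. [folklore] -/
theorem raiseSum_permAct (π : Equiv.Perm V) (b : (V → Fin 2) → ℝ) :
    raiseSum (permAct π b) = permAct π (raiseSum b) := by
  funext σ
  unfold raiseSum permAct
  simp only [Function.comp_apply]
  have h : ∀ x, (if σ (π x) = 0 then b (Function.update (σ ∘ ⇑π) x 1) else 0)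
      = (fun x' => if σ x' = 0 then b ((Function.update σ x' 1) ∘ ⇑π) else 0) (π x) := by
    intro x; simp only [update_comp_perm]
  calc (∑ x, if σ x = 0 then b (Function.update σ x 1 ∘ ⇑π) else 0)
      = ∑ x, (fun x' => if σ x' = 0 then b ((Function.update σ x' 1) ∘ ⇑π) else 0) (π x) :=
        (Equiv.sum_comp π (fun x' => if σ x' = 0 then b ((Function.update σ x' 1) ∘ ⇑π) else 0)).symm
    _ = ∑ x, if σ (π x) = 0 then b (Function.update (σ ∘ ⇑π) x 1) else 0 :=
        Finset.sum_congr rfl (fun x _ => (h x).symm)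

/-- linearity of `S⁺_tot` on amplitudes. -/
theorem raiseSum_add' (b c : (V → Fin 2) → ℝ) :
    raiseSum (fun σ => b σ + c σ) = fun σ => raiseSum b σ + raiseSum c σ := by
  funext σ; unfold raiseSum; rw [← Finset.sum_add_distrib]
  refine Finset.sum_congr rfl fun x _ => ?_
  split_ifs <;> simp

/-- `B†` is additive (difference form). [folklore] -/
theorem raiseSum_sub' (b c : (V → Fin 2) → ℝ) :
    raiseSum (fun σ => b σ - c σ) = fun σ => raiseSum b σ - raiseSum c σ := by
  funext σ; unfold raiseSum; rw [← Finset.sum_sub_distrib]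
  refine Finset.sum_congr rfl fun x _ => ?_
  split_ifs <;> simp

/-- `B†` commutes with finite sums. [folklore] -/
theorem raiseSum_finsum {ι : Type} (s : Finset ι) (F : ι → (V → Fin 2) → ℝ) :
    raiseSum (fun σ => ∑ i ∈ s, F i σ) = fun σ => ∑ i ∈ s, raiseSum (F i) σ := by
  funext σ; unfold raiseSum
  have hι : ∀ (z : V) (E : ℝ), (if σ z = 0 then E else 0) = (if σ z = 0 then (1:ℝ) else 0) * E := by
    intro z E; split_ifs <;> simp
  simp_rw [hι _ (∑ i ∈ s, _), Finset.mul_sum]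
  rw [Finset.sum_comm]
  refine Finset.sum_congr rfl fun i _ => Finset.sum_congr rfl fun z _ => ?_
  rw [hι z (F i _)]

/-- `B†` of a conditional amplitude. [folklore] -/
theorem raiseSum_ite (p : Prop) [Decidable p] (c : (V → Fin 2) → ℝ) :
    raiseSum (fun σ => if p then c σ else 0) = fun σ => if p then raiseSum c σ else 0 := by
  by_cases hp : p
  · simp only [hp, if_true]
  · simp only [hp, if_false]; exact raiseSum_zero

/-- the number of zeros is permutation invariant. -/
theorem zerosCard_comp_perm (σ : V → Fin 2) (π : Equiv.Perm V) : zerosCard (σ ∘ ⇑π) = zerosCard σ := by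
  unfold zerosCard
  congr 1
  rw [Finset.card_filter, Finset.card_filter]
  simp only [Function.comp_apply]
  exact Equiv.sum_comp π (fun z => if σ z = 0 then 1 else 0)

/-! ### H.2 the transposition form `A = H_FM − e₀ = ½ Σ_E (1 − T_xy)` -/

variable (G : SimpleGraph V) [DecidableRel G.Adj]

/-- `(A b)(σ) = ¼ Σ_x Σ_y [x ∼ y] (b σ − b(σ ∘ swap x y))` (ordered pairs; = ½ Σ_{edges}(1 − T_xy)). [folklore] -/
noncomputable def fmOp (b : (V → Fin 2) → ℝ) (σ : V → Fin 2) : ℝ :=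
  (1/4 : ℝ) * ∑ x, ∑ y, if G.Adj x y then (b σ - b (σ ∘ ⇑(Equiv.swap x y))) else 0

/-- `A` kills every permutation-invariant amplitude — in particular every function of the particle number
(sector indicators, the uniform sector amplitude φ₀). -/
theorem fmOp_of_swapInvariant (b : (V → Fin 2) → ℝ)
    (hb : ∀ x y, G.Adj x y → ∀ σ, b (σ ∘ ⇑(Equiv.swap x y)) = b σ) : fmOp G b = fun _ => 0 := by
  funext σ; unfold fmOp
  rw [Finset.sum_eq_zero]; · simp
  intro x _; rw [Finset.sum_eq_zero]; intro y _
  by_cases h : G.Adj x y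
  · simp [h, hb x y h σ]
  · simp [h]

/-- `A` kills every function of the particle number. [folklore] -/
theorem fmOp_sectorFun (g : ℝ → ℝ) : fmOp G (fun σ => g (zerosCard σ)) = fun _ => 0 :=
  fmOp_of_swapInvariant G _ (fun x y _ σ => by simp only [zerosCard_comp_perm])

/-- `A` commutes with `S⁺_tot` (it is `SU(2)`-invariant; here only the part we need). [folklore] -/
theorem raiseSum_fmOp (b : (V → Fin 2) → ℝ) : raiseSum (fmOp G b) = fmOp G (raiseSum b) := by
  have hF : fmOp G b = fun τ => (1/4 : ℝ) * ∑ x ∈ (univ : Finset V), (fun x τ => ∑ y ∈ (univ : Finset V),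
      (fun y τ => if G.Adj x y then (b τ - permAct (Equiv.swap x y) b τ) else 0) y τ) x τ := by
    funext τ; rfl
  rw [hF, raiseSum_smul, raiseSum_finsum]
  funext σ
  show (1/4 : ℝ) * ∑ x, raiseSum (fun τ => ∑ y, (fun y τ => if G.Adj x y then
      (b τ - permAct (Equiv.swap x y) b τ) else 0) y τ) σ = fmOp G (raiseSum b) σ
  simp_rw [raiseSum_finsum]
  unfold fmOp
  congr 1
  refine Finset.sum_congr rfl fun x _ => Finset.sum_congr rfl fun y _ => ?_
  rw [raiseSum_ite]
  by_cases hxy : G.Adj x y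
  · simp only [hxy, if_true]
    rw [raiseSum_sub', raiseSum_permAct]
    rfl
  · simp [hxy]

/-- reindexing by a transposition. -/
theorem sum_comp_swap (x y : V) (f : (V → Fin 2) → ℝ) :
    ∑ σ, f (σ ∘ ⇑(Equiv.swap x y)) = ∑ σ, f σ := by
  let e : (V → Fin 2) ≃ (V → Fin 2) :=
    ⟨fun σ => σ ∘ ⇑(Equiv.swap x y), fun σ => σ ∘ ⇑(Equiv.swap x y),
     fun σ => by funext z; simp [Function.comp_apply, Equiv.swap_apply_self],
     fun σ => by funext z; simp [Function.comp_apply, Equiv.swap_apply_self]⟩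
  exact Equiv.sum_comp e f

/-- **`A` IS A SUM OF SQUARES**: `⟨b, A b⟩ = ⅛ Σ_x Σ_y [x ∼ y] Σ_σ (b σ − b(σ∘swap x y))²` — hence `A ⪰ 0`
and `⟨b, A b⟩ = 0` forces `b` to be invariant under every edge transposition. [folklore] -/
theorem inner_fmOp_eq (b : (V → Fin 2) → ℝ) :
    ∑ σ, b σ * fmOp G b σ
      = (1/8 : ℝ) * ∑ x, ∑ y, if G.Adj x y then ∑ σ, (b σ - b (σ ∘ ⇑(Equiv.swap x y))) ^ 2 else 0 := by
  unfold fmOp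
  have key : ∀ x y : V, ∑ σ, b σ * (b σ - b (σ ∘ ⇑(Equiv.swap x y)))
      = (1/2 : ℝ) * ∑ σ, (b σ - b (σ ∘ ⇑(Equiv.swap x y))) ^ 2 := by
    intro x y
    have hre := sum_comp_swap x y (fun σ => b σ * (b σ - b (σ ∘ ⇑(Equiv.swap x y))))
    have hinv : ∀ σ : V → Fin 2, (σ ∘ ⇑(Equiv.swap x y)) ∘ ⇑(Equiv.swap x y) = σ := by
      intro σ; funext z; simp [Function.comp_apply, Equiv.swap_apply_self]
    simp only [hinv] at hre
    -- hre : Σ b(σs)(b(σs) − bσ) = Σ bσ(bσ − bσs)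
    have : 2 * ∑ σ, b σ * (b σ - b (σ ∘ ⇑(Equiv.swap x y)))
        = ∑ σ, (b σ - b (σ ∘ ⇑(Equiv.swap x y))) ^ 2 := by
      rw [two_mul]
      nth_rewrite 1 [← hre]
      rw [← Finset.sum_add_distrib]
      refine Finset.sum_congr rfl fun σ _ => ?_
      ring
    linarith
  simp_rw [Finset.mul_sum]
  rw [Finset.sum_comm]
  refine Finset.sum_congr rfl fun x _ => ?_
  rw [Finset.sum_comm]
  refine Finset.sum_congr rfl fun y _ => ?_
  by_cases hxy : G.Adj x y
  · simp only [hxy, if_true]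
    have : ∑ σ, b σ * ((1/4:ℝ) * (b σ - b (σ ∘ ⇑(Equiv.swap x y))))
        = (1/4:ℝ) * ∑ σ, b σ * (b σ - b (σ ∘ ⇑(Equiv.swap x y))) := by
      rw [Finset.mul_sum]; exact Finset.sum_congr rfl (fun σ _ => by ring)
    rw [this, key x y]; ring
  · simp [hxy]

/-- `⟨b, A b⟩ ≥ 0` (sum of squares). [folklore] -/
theorem inner_fmOp_nonneg (b : (V → Fin 2) → ℝ) : 0 ≤ ∑ σ, b σ * fmOp G b σ := by
  rw [inner_fmOp_eq]
  refine mul_nonneg (by norm_num) (Finset.sum_nonneg fun x _ => Finset.sum_nonneg fun y _ => ?_)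
  split_ifs
  · exact Finset.sum_nonneg fun σ _ => sq_nonneg _
  · exact le_refl _

/-- kernel characterisation (one direction): `⟨b, A b⟩ = 0` ⇒ `b` is invariant under every edge
transposition (so, on a connected graph, constant on each particle-number sector). -/
theorem swapInvariant_of_inner_fmOp_eq_zero (b : (V → Fin 2) → ℝ)
    (h0 : ∑ σ, b σ * fmOp G b σ = 0) :
    ∀ x y, G.Adj x y → ∀ σ, b (σ ∘ ⇑(Equiv.swap x y)) = b σ := by
  rw [inner_fmOp_eq] at h0
  have hsum : ∑ x, ∑ y, (if G.Adj x y then ∑ σ, (b σ - b (σ ∘ ⇑(Equiv.swap x y))) ^ 2 else 0) = 0 := by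
    have : (1/8 : ℝ) ≠ 0 := by norm_num
    exact (mul_eq_zero.mp h0).resolve_left this
  have hnn : ∀ x y, 0 ≤ (if G.Adj x y then ∑ σ, (b σ - b (σ ∘ ⇑(Equiv.swap x y))) ^ 2 else (0:ℝ)) := by
    intro x y; split_ifs
    · exact Finset.sum_nonneg fun σ _ => sq_nonneg _
    · exact le_refl _
  intro x y hxy σ
  have hx := (Finset.sum_eq_zero_iff_of_nonneg (fun x _ => Finset.sum_nonneg fun y _ => hnn x y)).mp hsum x
    (Finset.mem_univ _)
  have hy := (Finset.sum_eq_zero_iff_of_nonneg (fun y _ => hnn x y)).mp hx y (Finset.mem_univ _)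
  simp only [hxy, if_true] at hy
  have hσ := (Finset.sum_eq_zero_iff_of_nonneg (fun σ _ => sq_nonneg _)).mp hy σ (Finset.mem_univ _)
  have : b σ - b (σ ∘ ⇑(Equiv.swap x y)) = 0 := pow_eq_zero_iff (two_ne_zero) |>.mp hσ
  linarith

end Transposition

end Summit.HubbardSuperconductivity.HubbardSuperconductivity.Theorems.AnisotropyChord.Tower
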